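import Summits.BirchSwinnertonDyer.Rank1Residual.Additive.CyclotomicTowerSignedLocalIndex
import Summits.BirchSwinnertonDyer.Rank1Residual.Additive.CyclotomicTowerSignedLocalTransverseH1
import Literature.NumberTheory.EllipticCurves.DivisionPolynomialTorsion
import Mathlib.GroupTheory.PGroup
import HarnessLib

/-!
# Prop. 8.7 DESCENDS the `p`-tower: "no `p`-torsion in `E(K_{n,v})`" at EVERY layer `n` follows from
# the BOTTOM layer `E(K_{0,v})` alone — the `htors` hypothesis of files 1–4 of this series
# (p312958 / p313494 / p314385 / p314968) reduced to ONE local field (cell `b2b-bsdres`,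
# CLASS-CLOSURE lane, class O10 — x1b GEN 32, class lead; file 5 of the series)

HONEST FRAMING (cell `b2b-bsdres`, run/shared/lean/b2b/bsd-rank1-residual/, verbatim in every
file): the goal of the cell is to DELETE the COMBINATION-SHAPED residual classes of the
Birch–Swinnerton-Dyer formula for ALL analytic-rank `≤ 1` elliptic curves over `ℚ` — "full BSD
formula for every rank `≤ 1` curve in class `C`" assembled STRICTLY from published theorems — so
that the rank-`≤ 1` remainder becomes exactly the CONSTRUCTION-SHAPED classes, which are TYPED
(missing-input `Prop`s), NOT attempted. This is not "finishing BSD". CLASS-CLOSURE lane: prove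
what is provable now; shrink each hard class to its core with data; no claim beyond stated classes;
research routes on CONSTRUCTION-SHAPED X12 / O10; census / instrument output = EVIDENCE / conjecture
items, NEVER a Literature fact; `RESIDUAL-MAP.md` marks change only by signed lines. THIS FILE:
TOOL THEOREMS ONLY (a `p`-group fixed-point lemma for a normal pair of subgroups acting on an
abelian group with finite `p`-torsion, and its corollaries over cc-typer-6's
`localFixedPointsOfEmb` / `towerSignedLocalPointsOfEmb` / `towerSubgroup`) — no definition, no
named Literature fact, no Summits-side fact `def`, no `sorry`, axioms standard; Prop. 8.12 ii)
(generation half `hsum`) and Prop. 8.7 AT THE BOTTOM LAYER stay HYPOTHESES; nothing is booked; no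
label / mark / count / sub-cell moves; O10 stays OPEN / CONSTRUCTION-SHAPED; nothing about
`BSD(W, p)` of any pair is claimed.

## What is proved

* §1 (pure group action) `FixedPoints.eq_zero_of_prime_smul_eq_zero_of_index_dvd_pow`: `G` acts
  on an abelian group `M` with finite `M[p]`; `A ⊴ G`, `B ≤ G`, `[B : A ∩ B] ∣ p^k`. If `Fix(B)`
  has no element of order `p`, neither has `Fix(A)`: `V = Fix(A) ∩ M[p]` is finite and `B`-stable,
  acted on through a `p`-GROUP (`Subgroup.index_ker`, `IsPGroup.of_card`); a non-zero `v ∈ V`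
  gives `p ∣ #V` (`addOrderOf_dvd_natCard`), and Mathlib's
  `IsPGroup.exists_fixed_point_of_prime_dvd_card_of_fixed_point` (fixed point `0`) yields a
  NON-ZERO `B`-fixed element of `M[p]` — contradiction (Greenberg LNM 1716, proof of Prop. 4.8,
  p. 109; GLOBAL twin in the tree: `WeierstrassCurve.fixedPoints_kerSubgroup_geomPrimaryTorsion_eq_bot`).
* §2 (local points) `eq_zero_of_prime_smul_eq_zero_localFixedPointsOfEmb_of_index_dvd_pow`:
  `H₁, H₂ ≤ Γ_K`, `H₂` normal, local pair index `[(H₁)_E : (H₂)_E ∩ (H₁)_E] ∣ p^k` (e.g.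
  `[K_{n,v} : K_{m,v}] ∣ p^{n−m}`, file 4), `W` elliptic: **`E(L₁,w)[p] = 0 ⟹ E(L₂,w)[p] = 0`**;
  `eq_zero_of_pow_smul_eq_zero_of_forall`: `E(·)[p] = 0 ⟹ E(·)[p^∞] = 0`.
* §3 (generic tower `U` of files 2/3): Prop. 8.7 at layer `n` ⟸ Prop. 8.7 at layer `0` (under
  `hidx` + normality); files 2/3 re-exported with `htors` AT THE BOTTOM ONLY:
  `inf_towerSignedLocalPointsOfEmb_eq_top_of_bottom`, `exists_mem_zero_eq_nsmul_of_pow_nsmul_eq_add_of_bottom`,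
  `not_mem_localKummerOverOfEmb_neg_one_of_kummer_generator_of_bottom`.
* §4 (cc-typer-6's tower `towerSubgroup κ K₀`; Kobayashi: `K = ℚ`, `K₀ = ℚ(μ_p)`, `E = ℚ_p`,
  `K_{0,v} = ℚ_p(μ_p)`): `towerSubgroup_zero`; **`E(K_{m,v})[p] = 0 ⟹ E(K_{n,v})[p] = 0`
  (`m ≤ n`)** via file 4's `index_local_towerSubgroup_dvd_pow`; **`E(K_{0,v})[p] = 0 ⟹
  E(K_{n,v})[p^∞] = 0` for every `n`**; NET LOCAL STATUS of the series:
  `inf_towerSigned_towerSubgroup_eq_top_of_galRange` (**`E⁺(K_{n,v}) ∩ E⁻(K_{n,v}) = E(K_{−1,v})`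
  at every layer from `E(K_{0,v})[p] = 0` ALONE**) and
  `exists_eq_nsmul_of_pow_nsmul_eq_add_tower_of_galRange` ((T) at layer `n` ⟸ `hsum` at `n` ∧
  `E(K_{0,v})[p] = 0` ∧ `p` odd).

NOT proved (stays a hypothesis): the bottom instance `E(K_{0,v})[p] = 0` — for Kobayashi
`E(ℚ_p(μ_p))[p] = 0` at good supersingular `p` (height-2 formal group: non-zero `p`-torsion of `Ê`
has valuation `1/(p²−1) ∉ (1/(p−1))ℤ`), a formal-group input; and `hsum`. The descent
`K_{0,v} ⇝ K_{n,v}` is the group-theoretic part of Prop. 8.7 (`[K_{n,v} : K_{0,v}]` a `p`-power);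
the step `ℚ_p ⇝ ℚ_p(μ_p)` (degree `p − 1`) is not of this kind and is not claimed.

References: [Kobayashi2003] §2 p. 4, Prop. 8.7 (p. 16), Prop. 8.12 ii) (pp. 17–18), Lemma 8.17
(p. 19); [GreenbergLNM1716] §1 p. 62, proof of Prop. 4.8 (p. 109) (fixed-point principle);
[SilvermanAEC2009] Cor. III.6.4 (`E[n]` finite); [SerreGaloisCohomology1997] II.§1.1.
-/

noncomputable section

open scoped Classical AddSubgroup

universe u

namespace Summit.BirchSwinnertonDyer.Rank1Residual.Additive

open Literature.NumberTheory.EllipticCurves Literature.NumberTheory.GaloisRepresentations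
  Literature.NumberTheory.EllipticCurves.Kobayashi2003 ZpExtension

/-! ## §1 A `p`-group fixed-point lemma for a normal pair of subgroups -/

section Abstract

variable {G : Type*} [Group G] {M : Type*} [AddCommGroup M] [DistribMulAction G M]

/-- For `A` normal in `G`, the fixed points `Fix(A) ≤ M` are `G`-stable:
`a • (g • m) = g • ((g⁻¹ a g) • m) = g • m`. Greenberg, LNM 1716, §1 p. 62. [folklore] -/
theorem FixedPoints.smul_mem_addSubgroup_of_normal (A : Subgroup G) [hA : A.Normal] (g : G) {m : M}
    (hm : m ∈ FixedPoints.addSubgroup A M) : g • m ∈ FixedPoints.addSubgroup A M := by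
  rw [FixedPoints.mem_addSubgroup] at hm ⊢
  rintro ⟨a, ha⟩
  rw [Subgroup.mk_smul]
  have hconj : g⁻¹ * a * g ∈ A := by
    have h := hA.conj_mem a ha g⁻¹
    rwa [inv_inv] at h
  have h := hm ⟨g⁻¹ * a * g, hconj⟩
  rw [Subgroup.mk_smul] at h
  calc a • g • m = g • ((g⁻¹ * a * g) • m) := by rw [mul_smul, mul_smul, smul_inv_smul]
    _ = g • m := by rw [h]

/-- A subgroup without elements of order `q` has no elements of order `q^k` either:
`E(·)[q] = 0 ⟹ E(·)[q^∞] = 0`. [folklore] -/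
theorem eq_zero_of_pow_smul_eq_zero_of_forall (S : AddSubgroup M) {q : ℕ}
    (h : ∀ Q ∈ S, q • Q = 0 → Q = 0) (k : ℕ) : ∀ Q ∈ S, q ^ k • Q = 0 → Q = 0 := by
  induction k with
  | zero =>
    intro Q _ hQ
    rwa [pow_zero, one_smul] at hQ
  | succ k ih =>
    intro Q hQ hQk
    rw [pow_succ, mul_smul] at hQk
    exact h Q hQ (ih (q • Q) (S.nsmul_mem hQ q) hQk)

/-- **`p`-group fixed-point DESCENT for a normal pair.** Let `G` act on the abelian group `M` with
finite `p`-torsion `M[p]`, `A ⊴ G`, `B ≤ G` with `[B : A ∩ B] ∣ p^k`. If `Fix(B)` has no element of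
order `p`, then `Fix(A)` has none: `V = Fix(A) ∩ M[p]` is finite, `B`-stable, acted on through a
`p`-group; a non-zero element would make `p ∣ #V`, and then the `p`-group fixed-point theorem
(with the fixed point `0`) gives a non-zero `B`-fixed element of `V ⊆ M[p]`. Greenberg, LNM 1716,
proof of Prop. 4.8 (p. 109: "`M` is just a nonzero, finite, abelian `p`-group on which `Γ` acts.
Obviously, `M_Γ ≠ 0`", dually `M^Γ ≠ 0`). [cite: GreenbergLNM1716, §4 proof of Prop. 4.8 (p. 109); §1 p. 62] -/
theorem FixedPoints.eq_zero_of_prime_smul_eq_zero_of_index_dvd_pow {p : ℕ} [hp : Fact p.Prime]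
    (A B : Subgroup G) [A.Normal] {k : ℕ} (hidx : (A.subgroupOf B).index ∣ p ^ k)
    [hfin : Finite (M[(p : ℕ)])]
    (hB : ∀ m ∈ FixedPoints.addSubgroup B M, p • m = 0 → m = 0) :
    ∀ m ∈ FixedPoints.addSubgroup A M, p • m = 0 → m = 0 := by
  intro m hm hpm
  by_contra hm0
  -- `V = Fix(A) ∩ M[p]`, finite and `B`-stable
  set V : AddSubgroup M := FixedPoints.addSubgroup A M ⊓ M[(p : ℕ)] with hV
  have hmemV : ∀ {v : M}, v ∈ V ↔ v ∈ FixedPoints.addSubgroup A M ∧ p • v = 0 := by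
    intro v
    rw [hV, AddSubgroup.mem_inf, AddSubgroup.torsionBy.nsmul_iff]
  haveI hVfin : Finite V :=
    Finite.of_injective _ (AddSubgroup.inclusion_injective (inf_le_right : V ≤ _))
  have hstab : ∀ (b : B) (v : M), v ∈ V → (b : G) • v ∈ V := by
    intro b v hv
    rw [hmemV] at hv ⊢
    refine ⟨FixedPoints.smul_mem_addSubgroup_of_normal A (b : G) hv.1, ?_⟩
    rw [smul_comm, hv.2, smul_zero]
  -- the permutation action `ρ : B → Perm(V)`
  let ρ : B →* Equiv.Perm V :=
    { toFun := fun b ↦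
        { toFun := fun v ↦ ⟨(b : G) • (v : M), hstab b _ v.2⟩
          invFun := fun v ↦ ⟨(b : G)⁻¹ • (v : M), hstab b⁻¹ _ v.2⟩
          left_inv := fun v ↦ Subtype.ext (inv_smul_smul (b : G) (v : M))
          right_inv := fun v ↦ Subtype.ext (smul_inv_smul (b : G) (v : M)) }
      map_one' := Equiv.ext fun v ↦ Subtype.ext (one_smul G (v : M))
      map_mul' := fun b c ↦ Equiv.ext fun v ↦ Subtype.ext (mul_smul (b : G) (c : G) (v : M)) }
  have hρ : ∀ (b : B) (v : V), ((ρ b v : V) : M) = (b : G) • (v : M) := fun _ _ ↦ rfl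
  -- `A ∩ B` acts trivially (definition of `Fix(A)`), so the range of `ρ` is a `p`-group
  have hker : A.subgroupOf B ≤ ρ.ker := by
    intro b hb
    rw [Subgroup.mem_subgroupOf] at hb
    rw [MonoidHom.mem_ker]
    refine Equiv.ext fun v ↦ Subtype.ext ?_
    rw [hρ, Equiv.Perm.coe_one, id_eq]
    have h := (FixedPoints.mem_addSubgroup _ _ _).mp (hmemV.mp v.2).1 ⟨(b : G), hb⟩
    rwa [Subgroup.mk_smul] at h
  have hP : IsPGroup p ρ.range := by
    have h1 : ρ.ker.index ∣ p ^ k := (Subgroup.index_dvd_of_le hker).trans hidx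
    rw [Subgroup.index_ker] at h1
    obtain ⟨j, -, hj⟩ := (Nat.dvd_prime_pow hp.out).mp h1
    exact IsPGroup.of_card hj
  -- `m` is a non-zero element of `V` of order `p`, so `p ∣ #V`
  have hmV : m ∈ V := hmemV.mpr ⟨hm, hpm⟩
  have hdvd : p ∣ Nat.card V := by
    have hne : (⟨m, hmV⟩ : V) ≠ 0 := fun h ↦ hm0 (congrArg Subtype.val h)
    have hord : addOrderOf (⟨m, hmV⟩ : V) = p :=
      addOrderOf_eq_prime (Subtype.ext (by
        rw [AddSubmonoidClass.coe_nsmul, ZeroMemClass.coe_zero]; exact hpm)) hne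
    rw [← hord]
    exact addOrderOf_dvd_natCard _
  -- `0` is a fixed point; the `p`-group fixed-point theorem gives another one
  have h0 : (0 : V) ∈ MulAction.fixedPoints ρ.range V := by
    rintro ⟨π, hπ⟩
    obtain ⟨b, rfl⟩ := MonoidHom.mem_range.mp hπ
    rw [Subgroup.mk_smul, Equiv.Perm.smul_def]
    exact Subtype.ext (by rw [hρ, ZeroMemClass.coe_zero, smul_zero])
  obtain ⟨v, hv, hv0⟩ := hP.exists_fixed_point_of_prime_dvd_card_of_fixed_point V hdvd h0
  -- `v` is `B`-fixed and `p`-torsion, hence zero: contradiction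
  have hvB : (v : M) ∈ FixedPoints.addSubgroup B M := by
    rw [FixedPoints.mem_addSubgroup]
    intro b
    have h := hv ⟨ρ b, MonoidHom.mem_range.mpr ⟨b, rfl⟩⟩
    rw [Subgroup.mk_smul, Equiv.Perm.smul_def] at h
    have h' := congrArg (fun z : V ↦ (z : M)) h
    rw [Subgroup.smul_def]
    simpa only [hρ] using h'
  have hv00 : (v : M) = 0 := hB _ hvB (hmemV.mp v.2).2
  exact hv0 (Subtype.ext (by rw [hv00]; rfl)).symm

end Abstract

/-! ## §2 Local points: `E(L₁,w)[p] = 0 ⟹ E(L₂,w)[p] = 0` for a normal pair with `p`-power index -/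

section Local

variable {K : Type u} [Field K] {E : Type u} [Field E] [Algebra K E]
  (ι : AlgebraicClosure K →ₐ[K] AlgebraicClosure E) (W : WeierstrassCurve K) {p : ℕ} [hp : Fact p.Prime]

omit hp in
/-- Normality passes to the local subgroup: `H ⊴ Γ_K ⟹ H_E = (Γ_E → Γ_K)⁻¹(H) ⊴ Γ_E`
(`Subgroup.Normal.comap`). Serre, *Galois Cohomology*, II.§1.1. [cite: SerreGaloisCohomology1997, II.§1.1] -/
theorem normal_localSubgroupOfEmb (H : Subgroup (Field.absoluteGaloisGroup K)) [hH : H.Normal] :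
    (localSubgroupOfEmb H ι).Normal :=
  hH.comap _

omit hp in
/-- `E(K̄_E)[n]` is finite for `n ≠ 0` and `W` elliptic (Silverman *AEC* Cor. III.6.4, the tree's
`WeierstrassCurve.finite_torsionBy_baseChange` over `K̄_E`). [cite: SilvermanAEC2009, Cor. III.6.4] -/
theorem finite_torsionBy_localPoints [W.IsElliptic] {n : ℤ} (hn : n ≠ 0) :
    Finite ((localPoints W E)[n]) :=
  WeierstrassCurve.finite_torsionBy_baseChange W (AlgebraicClosure E) hn

/-- **Local `p`-torsion DESCENT.** For `H₁, H₂ ≤ Γ_K` with `H₂` normal and local pair index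
`[(H₁)_E : (H₂)_E ∩ (H₁)_E]` dividing `p^k` (for `H_i = Gal(K̄/L_i)`, `L₁ ⊆ L₂`: `[L₂,w : L₁,w] ∣ p^k`),
and `W` elliptic: if `E(L₁,w)` has no point of order `p`, then `E(L₂,w)` has none (§1 applied to
`Γ_E` acting on `E(K̄_E)`, whose `p`-torsion is finite). This is the group-theoretic half of
Kobayashi's Prop. 8.7 (`[k_n : k_0] = pⁿ`). [cite: Kobayashi2003, Prop. 8.7 (p. 16)]
[cite: GreenbergLNM1716, §4 proof of Prop. 4.8 (p. 109)] -/
theorem eq_zero_of_prime_smul_eq_zero_localFixedPointsOfEmb_of_index_dvd_pow [W.IsElliptic]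
    (H₁ H₂ : Subgroup (Field.absoluteGaloisGroup K)) [H₂.Normal] {k : ℕ}
    (hidx : ((localSubgroupOfEmb H₂ ι).subgroupOf (localSubgroupOfEmb H₁ ι)).index ∣ p ^ k)
    (h₁ : ∀ Q ∈ localFixedPointsOfEmb ι W H₁, p • Q = 0 → Q = 0) :
    ∀ Q ∈ localFixedPointsOfEmb ι W H₂, p • Q = 0 → Q = 0 := by
  haveI := normal_localSubgroupOfEmb ι H₂
  haveI : Finite ((localPoints W E)[(p : ℕ)]) :=
    finite_torsionBy_localPoints W (by exact_mod_cast hp.out.ne_zero)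
  exact FixedPoints.eq_zero_of_prime_smul_eq_zero_of_index_dvd_pow
    (localSubgroupOfEmb H₂ ι) (localSubgroupOfEmb H₁ ι) hidx h₁

end Local

/-! ## §3 A generic tower `U`: Prop. 8.7 at layer `n` from layer `0`; files 2/3 re-exported with the
bottom-layer hypothesis -/

section GenericTower

variable {K : Type u} [Field K] {E : Type u} [Field E] [Algebra K E]
  (ι : AlgebraicClosure K →ₐ[K] AlgebraicClosure E) (W : WeierstrassCurve K) [W.IsElliptic]
  {p : ℕ} [hp : Fact p.Prime]
  (U : ℕ → Subgroup (Field.absoluteGaloisGroup K)) [hU : ∀ n, (U n).FiniteIndex]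

omit hU in
/-- **Prop. 8.7 descends the tower**: for `U n` normal with local layer indices
`[K_{n,v} : K_{m,v}]` dividing powers of `p` (`hidx`, files 2/3), `E(K_{0,v})[p] = 0` implies
`E(K_{n,v})[p] = 0`. [cite: Kobayashi2003, Prop. 8.7 (p. 16)] -/
theorem eq_zero_of_prime_smul_eq_zero_localFixedPointsOfEmb_tower [hN : ∀ n, (U n).Normal] (n : ℕ)
    (hidx : ∀ m ≤ n, ∃ k : ℕ,
      ((localSubgroupOfEmb (U n) ι).subgroupOf (localSubgroupOfEmb (U m) ι)).index ∣ p ^ k)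
    (h₀ : ∀ Q ∈ localFixedPointsOfEmb ι W (U 0), p • Q = 0 → Q = 0) :
    ∀ Q ∈ localFixedPointsOfEmb ι W (U n), p • Q = 0 → Q = 0 := by
  obtain ⟨k, hk⟩ := hidx 0 (Nat.zero_le n)
  exact eq_zero_of_prime_smul_eq_zero_localFixedPointsOfEmb_of_index_dvd_pow ι W (U 0) (U n) hk h₀

/-- **Prop. 8.12 ii), first identity, at EVERY layer from the BOTTOM instance of Prop. 8.7** (file 2's
`inf_towerSignedLocalPointsOfEmb_eq_top` + the descent): `E⁺(K_{n,v}) ⊓ E⁻(K_{n,v}) = E(K_{−1,v})`.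
[cite: Kobayashi2003, Prop. 8.12 ii) (pp. 17–18), Def. 8.16 (p. 19), Prop. 8.7 (p. 16)] -/
theorem inf_towerSignedLocalPointsOfEmb_eq_top_of_bottom [hN : ∀ n, (U n).Normal] (n : ℕ)
    (htors₀ : ∀ Q ∈ localFixedPointsOfEmb ι W (U 0), p • Q = 0 → Q = 0)
    (hidx : ∀ m ≤ n, ∃ k : ℕ,
      ((localSubgroupOfEmb (U n) ι).subgroupOf (localSubgroupOfEmb (U m) ι)).index ∣ p ^ k) :
    towerSignedLocalPointsOfEmb U ι W 1 n ⊓ towerSignedLocalPointsOfEmb U ι W (-1) n =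
      localFixedPointsOfEmb ι W ⊤ :=
  inf_towerSignedLocalPointsOfEmb_eq_top U ι W n
    (eq_zero_of_prime_smul_eq_zero_localFixedPointsOfEmb_tower ι W U n hidx htors₀) hidx

/-- **Point-level transversality of the η-odd Kummer line, with Prop. 8.7 only at the bottom**
(file 2's `exists_mem_zero_eq_nsmul_of_pow_nsmul_eq_add'` + the descent): `P ∈ E(K_{0,v})` η-odd,
`p^j • P = M + p^{j+1} • Q`, `M ∈ E⁻(K_{n,v})`, `Q ∈ E(K_{n,v})` ⟹ `P ∈ p·E(K_{0,v})`.
[cite: Kobayashi2003, Prop. 8.12 ii) (pp. 17–18), Lemma 8.17 (p. 19), Prop. 8.7 (p. 16)] -/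
theorem exists_mem_zero_eq_nsmul_of_pow_nsmul_eq_add_of_bottom (hUa : Antitone U)
    [hN : ∀ n, (U n).Normal] (n : ℕ)
    (hsum : localFixedPointsOfEmb ι W (U n) ≤
      towerSignedLocalPointsOfEmb U ι W 1 n ⊔ towerSignedLocalPointsOfEmb U ι W (-1) n)
    (hodd : Odd p) (htors₀ : ∀ Q ∈ localFixedPointsOfEmb ι W (U 0), p • Q = 0 → Q = 0)
    (hidx : ∀ m ≤ n, ∃ k : ℕ,
      ((localSubgroupOfEmb (U n) ι).subgroupOf (localSubgroupOfEmb (U m) ι)).index ∣ p ^ k)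
    {P : localPoints W E} (hP : P ∈ localFixedPointsOfEmb ι W (U 0))
    {τ : Field.absoluteGaloisGroup E} (hτ : τ • P = -P) (j : ℕ)
    {M Q : localPoints W E} (hM : M ∈ towerSignedLocalPointsOfEmb U ι W (-1) n)
    (hQ : Q ∈ localFixedPointsOfEmb ι W (U n)) (hPMQ : p ^ j • P = M + p ^ (j + 1) • Q) :
    ∃ S ∈ localFixedPointsOfEmb ι W (U 0), P = p • S :=
  exists_mem_zero_eq_nsmul_of_pow_nsmul_eq_add' U ι W hUa n hsum hodd
    (eq_zero_of_prime_smul_eq_zero_localFixedPointsOfEmb_tower ι W U n hidx htors₀) hidx hP hτ j hM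
    hQ hPMQ

/-- **Class-level transversality with Prop. 8.7 only at the bottom** (file 3's
`not_mem_localKummerOverOfEmb_neg_one_of_kummer_generator` + the descent): for `g ∈ E(K_{0,v})`
η-odd, not `p`-divisible in `E(K_{0,v})`, no class of `H¹(U n, E[p^∞])` restricting at `ι` to the
Kummer class of `g ⊗ p^{−1}` lies in the Kummer condition cut out by `E⁻(K_{n,v})`.
[cite: Kobayashi2003, Def. 2.1 (p. 5), Prop. 8.12 ii) (pp. 17–18), Prop. 8.7 (p. 16)] -/
theorem not_mem_localKummerOverOfEmb_neg_one_of_kummer_generator_of_bottom (hUa : Antitone U)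
    [hN : ∀ n, (U n).Normal] (n : ℕ)
    (hsum : localFixedPointsOfEmb ι W (U n) ≤
      towerSignedLocalPointsOfEmb U ι W 1 n ⊔ towerSignedLocalPointsOfEmb U ι W (-1) n)
    (hodd : Odd p) (htors₀ : ∀ Q ∈ localFixedPointsOfEmb ι W (U 0), p • Q = 0 → Q = 0)
    (hidx : ∀ m ≤ n, ∃ k : ℕ,
      ((localSubgroupOfEmb (U n) ι).subgroupOf (localSubgroupOfEmb (U m) ι)).index ∣ p ^ k)
    {g : localPoints W E} (hg : g ∈ localFixedPointsOfEmb ι W (U 0))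
    {τ₀ : Field.absoluteGaloisGroup E} (hτ₀ : τ₀ • g = -g)
    (hndiv : ∀ S ∈ localFixedPointsOfEmb ι W (U 0), g ≠ p • S)
    {c : W.subgroupH1 p (U n)}
    (hcg : ∃ (ψ : contOneCocycles.{0, u} (discreteTopRep (U n) (W.geomPrimaryTorsion p)))
      (Q₁ : localPoints W E) (j : ℕ),
      oneCocycleClass (discreteTopRep (U n) (W.geomPrimaryTorsion p)) ψ = c ∧
        p ^ (j + 1) • Q₁ = p ^ j • g ∧
        ∀ τ : localSubgroupOfEmb (U n) ι,
          pointsMapOfEmb W ι ((ψ.1 (resGalSubgroupOfEmb (U n) ι τ) : W.geomPrimaryTorsion p) :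
            W.geomPoints) = (τ : Field.absoluteGaloisGroup E) • Q₁ - Q₁) :
    c ∉ localKummerOverOfEmb W p (U n) ι (towerSignedLocalPointsOfEmb U ι W (-1) n) :=
  not_mem_localKummerOverOfEmb_neg_one_of_kummer_generator ι W p U hUa n hsum hodd
    (eq_zero_of_prime_smul_eq_zero_localFixedPointsOfEmb_tower ι W U n hidx htors₀) hidx hg hτ₀ hndiv
    hcg

end GenericTower

/-! ## §4 cc-typer-6's tower `towerSubgroup κ K₀`: Prop. 8.7 over the whole tower from `E(K_{0,v})` -/

section Tower

variable {K : Type u} [Field K] {p : ℕ} [hp : Fact p.Prime] (κ : ZpExtension K p)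
  (K₀ : Type u) [Field K₀] [Algebra K K₀]
  {E : Type u} [Field E] [Algebra K E] (ι : AlgebraicClosure K →ₐ[K] AlgebraicClosure E)
  (W : WeierstrassCurve K)

/-- The bottom of the tower: `Gal(K̄/K₀·K_0^κ) = Gal(K̄/K₀)` (`K_0^κ = K`, `layerSubgroup_zero`); so
`E(K_{0,v}) = localFixedPointsOfEmb ι W (galRange K₀)` — for Kobayashi `E(ℚ_p(μ_p))`.
[cite: Kobayashi2003, §2 p. 4 (K_0 = ℚ(μ_p))] -/
theorem towerSubgroup_zero : towerSubgroup κ K₀ 0 = galRange (K := K) K₀ := by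
  change κ.layerSubgroup 0 ⊓ galRange (K := K) K₀ = galRange (K := K) K₀
  rw [κ.layerSubgroup_zero, top_inf_eq]

variable [(galRange (K := K) K₀).Normal] [W.IsElliptic]

/-- **`E(K_{m,v})[p] = 0 ⟹ E(K_{n,v})[p] = 0` for `m ≤ n`** along the tower `K₀·K_n^κ` (for `K₀/K`
Galois): §2 with the local layer index `[K_{n,v} : K_{m,v}] ∣ p^{n−m}` of file 4
(`index_local_towerSubgroup_dvd_pow`). [cite: Kobayashi2003, Prop. 8.7 (p. 16), §2 p. 4] -/
theorem eq_zero_of_prime_smul_eq_zero_localFixedPointsOfEmb_towerSubgroup {m n : ℕ} (hmn : m ≤ n)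
    (hm : ∀ Q ∈ localFixedPointsOfEmb ι W (towerSubgroup κ K₀ m), p • Q = 0 → Q = 0) :
    ∀ Q ∈ localFixedPointsOfEmb ι W (towerSubgroup κ K₀ n), p • Q = 0 → Q = 0 :=
  eq_zero_of_prime_smul_eq_zero_localFixedPointsOfEmb_of_index_dvd_pow ι W _ _
    (index_local_towerSubgroup_dvd_pow κ K₀ ι hmn) hm

/-- **`E(K_{0,v})[p] = 0 ⟹ E(K_{n,v})[p] = 0` for every `n`**, the bottom layer read as
`localFixedPointsOfEmb ι W (galRange K₀)` (`towerSubgroup_zero`). For Kobayashi's tower: no point of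
order `p` in `E(ℚ_p(μ_p))` ⟹ none in `E(ℚ_p(μ_{p^{n+1}}))`. [cite: Kobayashi2003, Prop. 8.7 (p. 16)] -/
theorem eq_zero_of_prime_smul_eq_zero_localFixedPointsOfEmb_towerSubgroup_of_galRange (n : ℕ)
    (h₀ : ∀ Q ∈ localFixedPointsOfEmb ι W (galRange (K := K) K₀), p • Q = 0 → Q = 0) :
    ∀ Q ∈ localFixedPointsOfEmb ι W (towerSubgroup κ K₀ n), p • Q = 0 → Q = 0 := by
  rw [← towerSubgroup_zero κ K₀] at h₀
  exact eq_zero_of_prime_smul_eq_zero_localFixedPointsOfEmb_towerSubgroup κ K₀ ι W (Nat.zero_le n) h₀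

/-- **Prop. 8.7's conclusion over the whole finite tower from its bottom instance**:
`E(K_{0,v})[p] = 0 ⟹ E(K_{n,v})[p^k] = 0` for all `n, k` (no `p`-power torsion at any layer).
[cite: Kobayashi2003, Prop. 8.7 (p. 16)] -/
theorem eq_zero_of_prime_pow_smul_eq_zero_localFixedPointsOfEmb_towerSubgroup_of_galRange (n k : ℕ)
    (h₀ : ∀ Q ∈ localFixedPointsOfEmb ι W (galRange (K := K) K₀), p • Q = 0 → Q = 0) :
    ∀ Q ∈ localFixedPointsOfEmb ι W (towerSubgroup κ K₀ n), p ^ k • Q = 0 → Q = 0 :=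
  eq_zero_of_pow_smul_eq_zero_of_forall _
    (eq_zero_of_prime_smul_eq_zero_localFixedPointsOfEmb_towerSubgroup_of_galRange κ K₀ ι W n h₀) k

variable [NumberField K] [NumberField K₀]

/-- **NET LOCAL STATUS of the series, intersection identity** (file 4 + the descent): for the tower
`K₀·K_n^κ` (`K₀/K` Galois), `W` elliptic: **`E⁺(K_{n,v}) ∩ E⁻(K_{n,v}) = E(K_{−1,v})` at EVERY layer
`n` from `E(K_{0,v})[p] = 0` alone.** [cite: Kobayashi2003, Prop. 8.12 ii) (pp. 17–18), Def. 8.16 (p. 19), Prop. 8.7 (p. 16)] -/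
theorem inf_towerSigned_towerSubgroup_eq_top_of_galRange (n : ℕ)
    (htors₀ : ∀ Q ∈ localFixedPointsOfEmb ι W (galRange (K := K) K₀), p • Q = 0 → Q = 0) :
    towerSignedLocalPointsOfEmb (towerSubgroup κ K₀) ι W 1 n ⊓
        towerSignedLocalPointsOfEmb (towerSubgroup κ K₀) ι W (-1) n =
      localFixedPointsOfEmb ι W ⊤ :=
  inf_towerSigned_towerSubgroup_eq_top κ K₀ ι W n
    (eq_zero_of_prime_smul_eq_zero_localFixedPointsOfEmb_towerSubgroup_of_galRange κ K₀ ι W n htors₀)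

/-- **NET LOCAL STATUS of the series, transversality (T)** (file 4's
`exists_eq_nsmul_of_pow_nsmul_eq_add_tower` + the descent): for the tower `K₀·K_n^κ`, an η-odd
bottom point `P ∈ E(K_{0,v})` with `p^j • P = M + p^{j+1} • Q`, `M ∈ E⁻(K_{n,v})`, `Q ∈ E(K_{n,v})`,
is `p`-divisible in `E(K_{0,v})` — from `hsum` at layer `n`, **`E(K_{0,v})[p] = 0`**, `p` odd.
[cite: Kobayashi2003, Prop. 8.12 ii) (pp. 17–18), Lemma 8.17 (p. 19), Prop. 8.7 (p. 16)] -/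
theorem exists_eq_nsmul_of_pow_nsmul_eq_add_tower_of_galRange (n : ℕ)
    (hsum : localFixedPointsOfEmb ι W (towerSubgroup κ K₀ n) ≤
      towerSignedLocalPointsOfEmb (towerSubgroup κ K₀) ι W 1 n ⊔
        towerSignedLocalPointsOfEmb (towerSubgroup κ K₀) ι W (-1) n)
    (hodd : Odd p)
    (htors₀ : ∀ Q ∈ localFixedPointsOfEmb ι W (galRange (K := K) K₀), p • Q = 0 → Q = 0)
    {P : localPoints W E} (hP : P ∈ localFixedPointsOfEmb ι W (towerSubgroup κ K₀ 0))
    {τ : Field.absoluteGaloisGroup E} (hτ : τ • P = -P) (j : ℕ)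
    {M Q : localPoints W E} (hM : M ∈ towerSignedLocalPointsOfEmb (towerSubgroup κ K₀) ι W (-1) n)
    (hQ : Q ∈ localFixedPointsOfEmb ι W (towerSubgroup κ K₀ n)) (hPMQ : p ^ j • P = M + p ^ (j + 1) • Q) :
    ∃ S ∈ localFixedPointsOfEmb ι W (towerSubgroup κ K₀ 0), P = p • S :=
  exists_eq_nsmul_of_pow_nsmul_eq_add_tower κ K₀ ι W n hsum hodd
    (eq_zero_of_prime_smul_eq_zero_localFixedPointsOfEmb_towerSubgroup_of_galRange κ K₀ ι W n htors₀)
    hP hτ j hM hQ hPMQ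

end Tower

end Summit.BirchSwinnertonDyer.Rank1Residual.Additive

end
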